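import Mathlib.LinearAlgebra.Matrix.Charpoly.Disc
import Mathlib.LinearAlgebra.Matrix.Charpoly.Coeff
import Mathlib.LinearAlgebra.Matrix.NonsingularInverse
import Mathlib.Tactic.Ring
import Mathlib.Tactic.NormNum
import HarnessLib

/-!
# `LinearAlgebra.Matrix.CayleyCharpolyDiscr` — the Cayley transform `c(X) = (1 + X)(1 − X)⁻¹` of a `3 × 3` matrix and the discriminant of its
# characteristic polynomial: `discr(χ_{c(X)}) · det(1 − X)⁴ = 2⁶ · discr(χ_X)`

Topic `LinearAlgebra/Matrix`; namespace `Literature.LinearAlgebra.Matrix`.  THEOREMS ONLY (no definition, no instance, no notation, no named fact, no `sorry`);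
Mathlib only (`Matrix.charpoly`, `Polynomial.discr` ∕ `Matrix.discr`, `Polynomial.discr_of_degree_eq_three`, `Matrix.nonsing_inv`).  The Cayley transform is
spelled out as the product `(1 + X) * (1 − X)⁻¹`, which is ★ `Literature.NumberTheory.Weil1982.UnitaryFinTopForm.cayley X` by `rfl` (`cayley_def`), so consumers on the
`U(σ, Φ₃)` model rewrite with `cayley_def` and apply these lemmas verbatim.

WHAT.  `R` a commutative ring, `X : Matrix (Fin 3) (Fin 3) R`.
* §1 `charpoly_fin_three` — the characteristic polynomial of a `3 × 3` matrix in closed form `χ_X = T³ − e₁T² + e₂T − e₃` (`e₁ = tr`, `e₂` = sum of the principal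
  `2 × 2` minors, `e₃ = det`, all spelled in the entries), its four coefficients, and the HOMOGENEOUS form `det(a·1 − b·X) = a³ + c₂a²b + c₁ab² + c₀b³` (`cₖ = χ_X.coeff k`).
* §2 the Cayley transform: `det(c(X))·det(1 − X) = det(1 + X)` and the polynomial identity **`χ_{c(X)} · det(1 − X) = (T − 1)³ + c₂(T − 1)²(T + 1) + c₁(T − 1)(T + 1)² + c₀(T + 1)³`**
  (`= (T + 1)³·χ_X((T − 1)∕(T + 1))`: the roots of `χ_{c(X)}` are the Möbius images `(1 + λ)∕(1 − λ)` of the roots `λ` of `χ_X`), for `det(1 − X)` a unit.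
* §3 **`discr_charpoly_cayley_mul_det_pow_four`**: `discr(χ_{c(X)}) · det(1 − X)⁴ = 2⁶ · discr(χ_X)` — the discriminant of a cubic is a weight-`6 = n(n−1)` semi-invariant of
  the Möbius substitution `T ↦ (T − 1)∕(T + 1)` (determinant `2`), and `discr(q∕a) = a⁻⁴·discr(q)`; with the `Matrix.discr` spelling and the `D_G`-shaped corollary
  `discr(χ_{c(X)})·(det(1 − X)·det(1 + X))² = 2⁶·discr(χ_X)·det(c(X))²` (the Weyl discriminant `D(g) = ±discr(χ_g)∕det(g)²` of `GL₃` read through the Cayley chart).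
Consumer: cell `hodgecm-mathlib`, road «HC-D» (holder F0P2-p01 (g23), LEAD T14-10 2026-09-02), brick D6(b): the group-level reduction `|D_G(z·c(X))| = |2|³·|η(X)|^{1∕2}·(unit)` of
Harish-Chandra's local integrability of `|D_G|^{−1∕2}` on `U(Φ₃)(F)` to the Lie algebra.  Count-neutral.

Proof route (no eigenvalues, no splitting field): `charmatrix(c(X)) · (1 − X) = (T − 1)·1 − (T + 1)·X` over `R[T]`, determinant of both sides, the homogeneous form of §1,
then coefficient comparison `det(1 − X)·dₖ = qₖ` and ONE `ring` identity in `(c₀, c₁, c₂)`.  Falsifier run first (road gate (G2)): the identity checked on 20 random rational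
matrices and on the two integer examples `X³ = 2`, `X³ = X + 1` (discriminants `−108 ↦ −6912`, `−23 ↦ −1472`, `det(1 − X) = −1`).

## References
* [BasuPollackRoy2006] S. Basu, R. Pollack, M.-F. Roy, *Algorithms in Real Algebraic Geometry*, 2nd ed. (2006), §4.1 Notation 4.1 (`Disc(P) = ∏_{i>j}(xᵢ − xⱼ)²`) and §4.2.2
  (discriminant ∕ subresultants of a cubic).
* [PlatonovRapinchuk1994] V. Platonov, A. Rapinchuk, *Algebraic Groups and Number Theory* (1994), §3.3 (the Cayley transform `(1 + X)(1 − X)⁻¹`).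
* [Rogawski1990] J. D. Rogawski, *Automorphic Representations of Unitary Groups in Three Variables*, Ann. of Math. Stud. 123 (1990), §4.9 p. 54 (`D_G(γ)`).
-/

set_option autoImplicit false

open Polynomial

namespace Literature.LinearAlgebra.Matrix

variable {R : Type*} [CommRing R]

/-! ## §1 The characteristic polynomial of a `3 × 3` matrix in closed form -/

/-- **`χ_X = T³ − e₁T² + e₂T − e₃`** for a `3 × 3` matrix, with `e₁ = tr X`, `e₂` the sum of the principal `2 × 2` minors and `e₃ = det X`, all in the entries
(`Matrix.det_fin_three` on the characteristic matrix). [cite: BasuPollackRoy2006, §4.2.2] -/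
theorem charpoly_fin_three (M : Matrix (Fin 3) (Fin 3) R) :
    M.charpoly = X ^ 3 - C (M 0 0 + M 1 1 + M 2 2) * X ^ 2
      + C (M 0 0 * M 1 1 - M 0 1 * M 1 0 + (M 0 0 * M 2 2 - M 0 2 * M 2 0) + (M 1 1 * M 2 2 - M 1 2 * M 2 1)) * X
      - C (M 0 0 * M 1 1 * M 2 2 - M 0 0 * M 1 2 * M 2 1 - M 0 1 * M 1 0 * M 2 2 + M 0 1 * M 1 2 * M 2 0
          + M 0 2 * M 1 0 * M 2 1 - M 0 2 * M 1 1 * M 2 0) := by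
  rw [Matrix.charpoly, Matrix.det_fin_three]
  simp only [Matrix.charmatrix_apply_eq, ne_eq, zero_ne_one, not_false_eq_true, Matrix.charmatrix_apply_ne, one_ne_zero,
    Fin.reduceEq, map_add, map_sub, map_mul]
  ring

/-- The coefficients of `χ_X` for a `3 × 3` matrix: `c₃ = 1`, `c₂ = −e₁`, `c₁ = e₂`, `c₀ = −e₃`. [cite: BasuPollackRoy2006, §4.2.2] -/
theorem charpoly_coeff_fin_three (M : Matrix (Fin 3) (Fin 3) R) :
    M.charpoly.coeff 3 = 1 ∧ M.charpoly.coeff 2 = -(M 0 0 + M 1 1 + M 2 2) ∧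
      M.charpoly.coeff 1 = M 0 0 * M 1 1 - M 0 1 * M 1 0 + (M 0 0 * M 2 2 - M 0 2 * M 2 0) + (M 1 1 * M 2 2 - M 1 2 * M 2 1) ∧
      M.charpoly.coeff 0 = -(M 0 0 * M 1 1 * M 2 2 - M 0 0 * M 1 2 * M 2 1 - M 0 1 * M 1 0 * M 2 2 + M 0 1 * M 1 2 * M 2 0
          + M 0 2 * M 1 0 * M 2 1 - M 0 2 * M 1 1 * M 2 0) := by
  rw [charpoly_fin_three]
  refine ⟨?_, ?_, ?_, ?_⟩ <;>
    · simp only [coeff_add, coeff_sub, coeff_C_mul, coeff_X_pow, coeff_C, coeff_X]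
      norm_num

/-- **Homogeneous characteristic polynomial of a `3 × 3` matrix**: `det(a·1 − b·X) = a³ + c₂a²b + c₁ab² + c₀b³` with `cₖ = χ_X.coeff k`
(`= b³·χ_X(a∕b)` when `b` is a unit; valid for all `a, b`). [cite: BasuPollackRoy2006, §4.2.2] -/
theorem det_smul_one_sub_smul_fin_three (M : Matrix (Fin 3) (Fin 3) R) (a b : R) :
    (a • (1 : Matrix (Fin 3) (Fin 3) R) - b • M).det =
      a ^ 3 + M.charpoly.coeff 2 * a ^ 2 * b + M.charpoly.coeff 1 * a * b ^ 2 + M.charpoly.coeff 0 * b ^ 3 := by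
  obtain ⟨-, h2, h1, h0⟩ := charpoly_coeff_fin_three M
  rw [h2, h1, h0, Matrix.det_fin_three]
  simp only [Matrix.sub_apply, Matrix.smul_apply, Matrix.one_apply_eq, ne_eq, zero_ne_one, not_false_eq_true, Matrix.one_apply_ne,
    one_ne_zero, Fin.reduceEq, smul_eq_mul, mul_one, mul_zero]
  ring

/-- `χ_X(1) = det(1 − X) = 1 + c₂ + c₁ + c₀` for a `3 × 3` matrix. [cite: BasuPollackRoy2006, §4.2.2] -/
theorem det_one_sub_fin_three (M : Matrix (Fin 3) (Fin 3) R) :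
    (1 - M).det = 1 + M.charpoly.coeff 2 + M.charpoly.coeff 1 + M.charpoly.coeff 0 := by
  have h := det_smul_one_sub_smul_fin_three M 1 1
  simp only [one_smul, one_pow, mul_one] at h
  exact h

/-! ## §2 The Cayley transform `c(X) = (1 + X)(1 − X)⁻¹`: determinant and characteristic polynomial -/

section Cayley

variable {n : Type*} [Fintype n] [DecidableEq n]

/-- `det(c(X)) · det(1 − X) = det(1 + X)` for `det(1 − X)` a unit. [cite: PlatonovRapinchuk1994, §3.3] -/
theorem det_cayley_mul_det (A : Matrix n n R) (h : IsUnit (1 - A).det) :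
    ((1 + A) * (1 - A)⁻¹).det * (1 - A).det = (1 + A).det := by
  rw [← Matrix.det_mul, Matrix.nonsing_inv_mul_cancel_right _ _ h]

/-- The characteristic matrix of the Cayley transform clears its denominator: `charmatrix(c(X)) · (1 − X) = (T − 1)·1 − (T + 1)·X` over `R[T]`.
[cite: PlatonovRapinchuk1994, §3.3] -/
theorem charmatrix_cayley_mul (A : Matrix n n R) (h : IsUnit (1 - A).det) :
    Matrix.charmatrix ((1 + A) * (1 - A)⁻¹) * (1 - A).map C =
      (X - 1 : R[X]) • (1 : Matrix n n R[X]) - (X + 1 : R[X]) • A.map C := by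
  have hmul : (((1 + A) * (1 - A)⁻¹).map (C : R →+* R[X]) : Matrix n n R[X]) * (1 - A).map C = (1 + A).map C := by
    rw [← Matrix.map_mul, Matrix.nonsing_inv_mul_cancel_right _ _ h]
  have hsc : Matrix.scalar n (X : R[X]) * (1 - A).map C = (X : R[X]) • (1 - A).map C := by
    rw [Matrix.scalar_apply, ← Matrix.smul_eq_diagonal_mul]
  rw [Matrix.charmatrix, RingHom.mapMatrix_apply, sub_mul, hmul, hsc, Matrix.map_sub _ (map_sub C), Matrix.map_add _ (map_add C),
    Matrix.map_one C C.map_zero C.map_one]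
  rw [smul_sub, sub_smul, add_smul, one_smul, one_smul]
  abel

/-- **`χ_{c(X)} · det(1 − X) = det((T − 1)·1 − (T + 1)·X)`** (any size). [cite: PlatonovRapinchuk1994, §3.3] -/
theorem charpoly_cayley_mul_C_det (A : Matrix n n R) (h : IsUnit (1 - A).det) :
    ((1 + A) * (1 - A)⁻¹).charpoly * C (1 - A).det = ((X - 1 : R[X]) • (1 : Matrix n n R[X]) - (X + 1 : R[X]) • A.map C).det := by
  rw [Matrix.charpoly, RingHom.map_det, RingHom.mapMatrix_apply, ← Matrix.det_mul, charmatrix_cayley_mul A h]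

end Cayley

/-- **The characteristic polynomial of the Cayley transform of a `3 × 3` matrix**: for `det(1 − X)` a unit,
`χ_{c(X)} · det(1 − X) = (T − 1)³ + c₂(T − 1)²(T + 1) + c₁(T − 1)(T + 1)² + c₀(T + 1)³ = (T + 1)³ χ_X((T − 1)∕(T + 1))`, `cₖ = χ_X.coeff k`.
[cite: PlatonovRapinchuk1994, §3.3] [cite: BasuPollackRoy2006, §4.2.2] -/
theorem charpoly_cayley_mul_C_det_fin_three (A : Matrix (Fin 3) (Fin 3) R) (h : IsUnit (1 - A).det) :
    ((1 + A) * (1 - A)⁻¹).charpoly * C (1 - A).det =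
      (X - 1) ^ 3 + C (A.charpoly.coeff 2) * (X - 1) ^ 2 * (X + 1) + C (A.charpoly.coeff 1) * (X - 1) * (X + 1) ^ 2
        + C (A.charpoly.coeff 0) * (X + 1) ^ 3 := by
  rw [charpoly_cayley_mul_C_det A h, det_smul_one_sub_smul_fin_three, Matrix.charpoly_map, coeff_map, coeff_map, coeff_map]

/-- Coefficient comparison: `det(1 − X) · dₖ = qₖ(c₀, c₁, c₂)` for the coefficients `dₖ` of `χ_{c(X)}` (`k = 0, 1, 2`), and `d₃ = 1`.
[cite: BasuPollackRoy2006, §4.2.2] -/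
theorem charpoly_cayley_coeff_mul_det_fin_three (A : Matrix (Fin 3) (Fin 3) R) (h : IsUnit (1 - A).det) :
    ((1 + A) * (1 - A)⁻¹).charpoly.coeff 3 = 1 ∧
      ((1 + A) * (1 - A)⁻¹).charpoly.coeff 2 * (1 - A).det = -3 - A.charpoly.coeff 2 + A.charpoly.coeff 1 + 3 * A.charpoly.coeff 0 ∧
      ((1 + A) * (1 - A)⁻¹).charpoly.coeff 1 * (1 - A).det = 3 - A.charpoly.coeff 2 - A.charpoly.coeff 1 + 3 * A.charpoly.coeff 0 ∧
      ((1 + A) * (1 - A)⁻¹).charpoly.coeff 0 * (1 - A).det = -1 + A.charpoly.coeff 2 - A.charpoly.coeff 1 + A.charpoly.coeff 0 := by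
  have hq := charpoly_cayley_mul_C_det_fin_three A h
  have hexp : (X - 1 : R[X]) ^ 3 + C (A.charpoly.coeff 2) * (X - 1) ^ 2 * (X + 1) + C (A.charpoly.coeff 1) * (X - 1) * (X + 1) ^ 2
        + C (A.charpoly.coeff 0) * (X + 1) ^ 3 =
      C (1 + A.charpoly.coeff 2 + A.charpoly.coeff 1 + A.charpoly.coeff 0) * X ^ 3
        + C (-3 - A.charpoly.coeff 2 + A.charpoly.coeff 1 + 3 * A.charpoly.coeff 0) * X ^ 2
        + C (3 - A.charpoly.coeff 2 - A.charpoly.coeff 1 + 3 * A.charpoly.coeff 0) * X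
        + C (-1 + A.charpoly.coeff 2 - A.charpoly.coeff 1 + A.charpoly.coeff 0) := by
    simp only [map_add, map_sub, map_mul, map_neg, map_one, map_ofNat]
    ring
  rw [hexp] at hq
  have hk : ∀ k, ((1 + A) * (1 - A)⁻¹).charpoly.coeff k * (1 - A).det =
      (C (1 + A.charpoly.coeff 2 + A.charpoly.coeff 1 + A.charpoly.coeff 0) * X ^ 3
        + C (-3 - A.charpoly.coeff 2 + A.charpoly.coeff 1 + 3 * A.charpoly.coeff 0) * X ^ 2
        + C (3 - A.charpoly.coeff 2 - A.charpoly.coeff 1 + 3 * A.charpoly.coeff 0) * X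
        + C (-1 + A.charpoly.coeff 2 - A.charpoly.coeff 1 + A.charpoly.coeff 0)).coeff k := by
    intro k
    rw [← hq, coeff_mul_C]
  refine ⟨(charpoly_coeff_fin_three _).1, ?_, ?_, ?_⟩
  · rw [hk 2]; simp only [coeff_add, coeff_C_mul, coeff_X_pow, coeff_C, coeff_X]; norm_num
  · rw [hk 1]; simp only [coeff_add, coeff_C_mul, coeff_X_pow, coeff_C, coeff_X]; norm_num
  · rw [hk 0]; simp only [coeff_add, coeff_C_mul, coeff_X_pow, coeff_C, coeff_X]; norm_num

/-! ## §3 The discriminant identity -/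

/-- **`discr(χ_{c(X)}) · det(1 − X)⁴ = 2⁶ · discr(χ_X)`** for a `3 × 3` matrix `X` over a commutative ring with `det(1 − X)` a unit, `c(X) = (1 + X)(1 − X)⁻¹`:
the roots of `χ_{c(X)}` are `(1 + λᵢ)∕(1 − λᵢ)`, so `∏_{i<j}(μᵢ − μⱼ)² = 2⁶ ∏_{i<j}(λᵢ − λⱼ)² ∕ ∏ᵢ(1 − λᵢ)⁴`; proved denominator-free by coefficient comparison and one `ring`
identity (Mathlib `Polynomial.discr_of_degree_eq_three`). [cite: BasuPollackRoy2006, §4.1 Notation 4.1] [cite: PlatonovRapinchuk1994, §3.3] -/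
theorem discr_charpoly_cayley_mul_det_pow_four (A : Matrix (Fin 3) (Fin 3) R) (h : IsUnit (1 - A).det) :
    ((1 + A) * (1 - A)⁻¹).charpoly.discr * (1 - A).det ^ 4 = 2 ^ 6 * A.charpoly.discr := by
  nontriviality R
  have hdeg : ∀ M : Matrix (Fin 3) (Fin 3) R, M.charpoly.degree = 3 := fun M => by
    rw [Matrix.charpoly_degree_eq_dim]; rfl
  obtain ⟨h3, h2, h1, h0⟩ := charpoly_cayley_coeff_mul_det_fin_three A h
  have hp3 : A.charpoly.coeff 3 = 1 := (charpoly_coeff_fin_three A).1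
  have hδ := det_one_sub_fin_three A
  rw [discr_of_degree_eq_three (hdeg _), discr_of_degree_eq_three (hdeg _), h3, hp3]
  set d2 := ((1 + A) * (1 - A)⁻¹).charpoly.coeff 2
  set d1 := ((1 + A) * (1 - A)⁻¹).charpoly.coeff 1
  set d0 := ((1 + A) * (1 - A)⁻¹).charpoly.coeff 0
  set δ := (1 - A).det
  have key : (d2 ^ 2 * d1 ^ 2 - 4 * 1 * d1 ^ 3 - 4 * d2 ^ 3 * d0 - 27 * 1 ^ 2 * d0 ^ 2 + 18 * 1 * d2 * d1 * d0) * δ ^ 4 =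
      (d2 * δ) ^ 2 * (d1 * δ) ^ 2 - 4 * δ * (d1 * δ) ^ 3 - 4 * (d2 * δ) ^ 3 * (d0 * δ) - 27 * δ ^ 2 * (d0 * δ) ^ 2
        + 18 * δ * (d2 * δ) * (d1 * δ) * (d0 * δ) := by ring
  rw [key, h2, h1, h0, hδ]
  ring

/-- The same identity in Mathlib's `Matrix.discr` spelling (`Matrix.discr X = discr(χ_X)`). [cite: BasuPollackRoy2006, §4.1 Notation 4.1] -/
theorem matrix_discr_cayley_mul_det_pow_four (A : Matrix (Fin 3) (Fin 3) R) (h : IsUnit (1 - A).det) :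
    Matrix.discr ((1 + A) * (1 - A)⁻¹) * (1 - A).det ^ 4 = 2 ^ 6 * Matrix.discr A :=
  discr_charpoly_cayley_mul_det_pow_four A h

/-- **`D_G`-shaped corollary**: with `det(c(X))·det(1 − X) = det(1 + X)`,
`discr(χ_{c(X)}) · (det(1 − X)·det(1 + X))² = 2⁶ · discr(χ_X) · det(c(X))²` — i.e. `discr(χ_{c(X)})∕det(c(X))² = 2⁶·discr(χ_X)∕(det(1 − X)·det(1 + X))²` without
denominators (the Weyl discriminant `D(g) = ±discr(χ_g)∕det(g)²` of `GL₃` read through the Cayley chart). [cite: Rogawski1990, §4.9 p. 54] [cite: PlatonovRapinchuk1994, §3.3] -/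
theorem discr_charpoly_cayley_mul_det_sq (A : Matrix (Fin 3) (Fin 3) R) (h : IsUnit (1 - A).det) :
    ((1 + A) * (1 - A)⁻¹).charpoly.discr * ((1 - A).det * (1 + A).det) ^ 2 =
      2 ^ 6 * A.charpoly.discr * ((1 + A) * (1 - A)⁻¹).det ^ 2 := by
  rw [← det_cayley_mul_det A h, ← discr_charpoly_cayley_mul_det_pow_four A h]
  ring

end Literature.LinearAlgebra.Matrix
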